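import Summits.Ventures.CertifiedManyBodySolver.Downfold.EmeryHoppingLevers
import HarnessLib

/-!
# THE FERMI ENERGY OF A TYPED BOX IS BRACKETED BY TWO OPPOSITE CORNERS: `ε_F` is non-increasing in `Δ` and `t_pp′`, non-decreasing in
# `t_pd²` and `t_pp`, so over a parameter box its extreme values sit at the corners `(Δ₂, t_pd,1, t_pp,1, t_pp′,2)` and `(Δ₁, t_pd,2, t_pp,2, t_pp′,1)`

Venture CertifiedManyBodySolver, cell `pub/hubbard-downfold` (stage S1; INFLATION-RULES-3to1-B §B.83 (i)), seat hubbard-downfold-mod-4 (technique B,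
g34); namespace `Summit.Ventures.CertifiedManyBodySolver.Downfold.Emery`. Everything PROVED (0 sorry, no definition). WHAT THIS IS NOT: a statement
about any material; `U = 0` one-body kinematics of the σ (d–p_x–p_y + t_pp, t_pp′) model; no number lives here.

THE RULE (S2-facing). A typed three-band box is a product `Δ ∈ [Δ₁, Δ₂]`, `t_pd ∈ [a₁, a₂]`, `t_pp ∈ [b₁, b₂]`, `t_pp′ ∈ [c₁, c₂]` (all non-negative,
`Δ₁ > 0`, `a₁ > 0`). The census certifies Fermi-energy brackets at POINT rows; `EmeryFermiFilling*` certified box brackets by a sub-box × energy-piece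
device. The four signed levers of §B.83 (f), (h) give the box bracket from TWO POINT ROWS: for every member `θ` of the box and every filling
`0 < ν < 1` attained throughout the box,
**`ε_F(Δ₂, a₁, b₁, c₂; ν) ≤ ε_F(θ; ν) ≤ ε_F(Δ₁, a₂, b₂, c₁; ν)`** (`fermiEnergyOf_mem_Icc_of_mem_box`) — a two-corner rule: the census at the
«low» corner (large Δ, small t_pd, small t_pp, large t_pp′) and at the «high» corner bounds the Fermi energy of the whole box.

Sources: three-band model [HybertsenSchluterChristensen1989, Eq. (1)]; monotone composition [folklore].
-/

noncomputable section

namespace Summit.Ventures.CertifiedManyBodySolver.Downfold.Emery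

open Real Set

/-- One coordinate at a time: `Δ ↑` lowers, `t_pd ↑` raises, `t_pp ↑` raises, `t_pp′ ↑` lowers the Fermi energy — chained from `θ` to the LOW corner.
[folklore] -/
theorem fermiEnergyOf_lowCorner_le {Δ a b c Δ₂ a₁ b₁ c₂ ν : ℝ} (hΔ : 0 < Δ) (hΔ₂ : Δ ≤ Δ₂) (ha₁ : 0 < a₁) (ha : a₁ ≤ a) (hb₁ : 0 ≤ b₁) (hb : b₁ ≤ b)
    (hc : 0 ≤ c) (hc₂ : c ≤ c₂) (hν0 : 0 < ν) (hν1 : ν < 1)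
    (hex0 : ∃ ε : ℝ, abFilling Δ a b c ε = ν) (hex1 : ∃ ε : ℝ, abFilling Δ₂ a b c ε = ν) (hex2 : ∃ ε : ℝ, abFilling Δ₂ a₁ b c ε = ν)
    (hex3 : ∃ ε : ℝ, abFilling Δ₂ a₁ b₁ c ε = ν) (hex4 : ∃ ε : ℝ, abFilling Δ₂ a₁ b₁ c₂ ε = ν) :
    fermiEnergyOf Δ₂ a₁ b₁ c₂ ν ≤ fermiEnergyOf Δ a b c ν := by
  have hΔ₂pos : 0 < Δ₂ := lt_of_lt_of_le hΔ hΔ₂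
  have hapos : 0 < a := lt_of_lt_of_le ha₁ ha
  -- step 1: Δ → Δ₂ (lowers)
  have s1 : fermiEnergyOf Δ₂ a b c ν ≤ fermiEnergyOf Δ a b c ν := by
    have h := fermiEnergyOf_shift_le (δ := Δ₂ - Δ) hΔ hapos.ne' hc (hb₁.trans hb) (by linarith) hν0 hν1 hex0
      (by rw [show Δ + (Δ₂ - Δ) = Δ₂ by ring]; exact hex1)
    rw [show Δ + (Δ₂ - Δ) = Δ₂ by ring] at h; exact h
  -- step 2: a → a₁ (lowers, since a₁² ≤ a²)
  have s2 : fermiEnergyOf Δ₂ a₁ b c ν ≤ fermiEnergyOf Δ₂ a b c ν :=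
    fermiEnergyOf_mono_tpdSq hΔ₂pos.le hc (hb₁.trans hb) (by nlinarith) hν0 hν1 hex2 hex1
  -- step 3: b → b₁ (lowers)
  have s3 : fermiEnergyOf Δ₂ a₁ b₁ c ν ≤ fermiEnergyOf Δ₂ a₁ b c ν :=
    fermiEnergyOf_mono_tpp hΔ₂pos.le hc hb₁ hb hν0 hν1 hex3 hex2
  -- step 4: c → c₂ (lowers)
  have s4 : fermiEnergyOf Δ₂ a₁ b₁ c₂ ν ≤ fermiEnergyOf Δ₂ a₁ b₁ c ν := by
    have h := fermiEnergyOf_anti_tppP (γ := c₂ - c) hΔ₂pos ha₁.ne' hc hb₁ (by linarith) hν0 hν1 hex3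
      (by rw [show c + (c₂ - c) = c₂ by ring]; exact hex4)
    rw [show c + (c₂ - c) = c₂ by ring] at h; exact h
  linarith

/-- Chained from `θ` to the HIGH corner. [folklore] -/
theorem fermiEnergyOf_le_highCorner {Δ a b c Δ₁ a₂ b₂ c₁ ν : ℝ} (hΔ₁ : 0 < Δ₁) (hΔ : Δ₁ ≤ Δ) (ha0 : 0 < a) (ha : a ≤ a₂) (hb0 : 0 ≤ b) (hb : b ≤ b₂)
    (hc₁ : 0 ≤ c₁) (hc : c₁ ≤ c) (hν0 : 0 < ν) (hν1 : ν < 1)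
    (hex0 : ∃ ε : ℝ, abFilling Δ a b c ε = ν) (hex1 : ∃ ε : ℝ, abFilling Δ₁ a b c ε = ν) (hex2 : ∃ ε : ℝ, abFilling Δ₁ a₂ b c ε = ν)
    (hex3 : ∃ ε : ℝ, abFilling Δ₁ a₂ b₂ c ε = ν) (hex4 : ∃ ε : ℝ, abFilling Δ₁ a₂ b₂ c₁ ε = ν) :
    fermiEnergyOf Δ a b c ν ≤ fermiEnergyOf Δ₁ a₂ b₂ c₁ ν := by
  have hcnn : 0 ≤ c := hc₁.trans hc
  have ha₂ : 0 < a₂ := lt_of_lt_of_le ha0 ha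
  -- step 1: Δ₁ ≤ Δ: ε_F(Δ) ≤ ε_F(Δ₁)
  have s1 : fermiEnergyOf Δ a b c ν ≤ fermiEnergyOf Δ₁ a b c ν := by
    have h := fermiEnergyOf_shift_le (δ := Δ - Δ₁) hΔ₁ ha0.ne' hcnn hb0 (by linarith) hν0 hν1 hex1
      (by rw [show Δ₁ + (Δ - Δ₁) = Δ by ring]; exact hex0)
    rw [show Δ₁ + (Δ - Δ₁) = Δ by ring] at h; exact h
  -- step 2: a ≤ a₂ raises
  have s2 : fermiEnergyOf Δ₁ a b c ν ≤ fermiEnergyOf Δ₁ a₂ b c ν :=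
    fermiEnergyOf_mono_tpdSq hΔ₁.le hcnn hb0 (by nlinarith) hν0 hν1 hex1 hex2
  -- step 3: b ≤ b₂ raises
  have s3 : fermiEnergyOf Δ₁ a₂ b c ν ≤ fermiEnergyOf Δ₁ a₂ b₂ c ν :=
    fermiEnergyOf_mono_tpp hΔ₁.le hcnn hb0 hb hν0 hν1 hex2 hex3
  -- step 4: c₁ ≤ c: ε_F(c) ≤ ε_F(c₁)
  have s4 : fermiEnergyOf Δ₁ a₂ b₂ c ν ≤ fermiEnergyOf Δ₁ a₂ b₂ c₁ ν := by
    have h := fermiEnergyOf_anti_tppP (γ := c - c₁) hΔ₁ ha₂.ne' hc₁ (hb0.trans hb) (by linarith) hν0 hν1 hex4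
      (by rw [show c₁ + (c - c₁) = c by ring]; exact hex3)
    rw [show c₁ + (c - c₁) = c by ring] at h; exact h
  linarith

/-- **TWO-CORNER RULE FOR THE FERMI ENERGY OF A TYPED BOX**: for every member `(Δ, t_pd, t_pp, t_pp′)` of the box
`[Δ₁, Δ₂] × [a₁, a₂] × [b₁, b₂] × [c₁, c₂]` (`Δ₁ > 0`, `a₁ > 0`, `b₁, c₁ ≥ 0`) and every filling `0 < ν < 1` attained at every row of the box,
**`ε_F(Δ₂, a₁, b₁, c₂; ν) ≤ ε_F(Δ, t_pd, t_pp, t_pp′; ν) ≤ ε_F(Δ₁, a₂, b₂, c₁; ν)`**. [folklore] -/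
theorem fermiEnergyOf_mem_Icc_of_mem_box {Δ a b c Δ₁ Δ₂ a₁ a₂ b₁ b₂ c₁ c₂ ν : ℝ} (hΔ₁ : 0 < Δ₁) (ha₁ : 0 < a₁) (hb₁ : 0 ≤ b₁) (hc₁ : 0 ≤ c₁)
    (hΔ : Δ ∈ Icc Δ₁ Δ₂) (ha : a ∈ Icc a₁ a₂) (hb : b ∈ Icc b₁ b₂) (hc : c ∈ Icc c₁ c₂) (hν0 : 0 < ν) (hν1 : ν < 1)
    (hexB : ∀ Δ' a' b' c' : ℝ, Δ' ∈ Icc Δ₁ Δ₂ → a' ∈ Icc a₁ a₂ → b' ∈ Icc b₁ b₂ → c' ∈ Icc c₁ c₂ → ∃ ε : ℝ, abFilling Δ' a' b' c' ε = ν) :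
    fermiEnergyOf Δ a b c ν ∈ Icc (fermiEnergyOf Δ₂ a₁ b₁ c₂ ν) (fermiEnergyOf Δ₁ a₂ b₂ c₁ ν) := by
  have hΔ1m : Δ₁ ∈ Icc Δ₁ Δ₂ := ⟨le_rfl, hΔ.1.trans hΔ.2⟩
  have hΔ2m : Δ₂ ∈ Icc Δ₁ Δ₂ := ⟨hΔ.1.trans hΔ.2, le_rfl⟩
  have ha1m : a₁ ∈ Icc a₁ a₂ := ⟨le_rfl, ha.1.trans ha.2⟩
  have ha2m : a₂ ∈ Icc a₁ a₂ := ⟨ha.1.trans ha.2, le_rfl⟩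
  have hb1m : b₁ ∈ Icc b₁ b₂ := ⟨le_rfl, hb.1.trans hb.2⟩
  have hb2m : b₂ ∈ Icc b₁ b₂ := ⟨hb.1.trans hb.2, le_rfl⟩
  have hc1m : c₁ ∈ Icc c₁ c₂ := ⟨le_rfl, hc.1.trans hc.2⟩
  have hc2m : c₂ ∈ Icc c₁ c₂ := ⟨hc.1.trans hc.2, le_rfl⟩
  constructor
  · exact fermiEnergyOf_lowCorner_le (lt_of_lt_of_le hΔ₁ hΔ.1) hΔ.2 ha₁ ha.1 hb₁ hb.1 (hc₁.trans hc.1) hc.2 hν0 hν1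
      (hexB _ _ _ _ hΔ ha hb hc) (hexB _ _ _ _ hΔ2m ha hb hc) (hexB _ _ _ _ hΔ2m ha1m hb hc) (hexB _ _ _ _ hΔ2m ha1m hb1m hc)
      (hexB _ _ _ _ hΔ2m ha1m hb1m hc2m)
  · exact fermiEnergyOf_le_highCorner hΔ₁ hΔ.1 (lt_of_lt_of_le ha₁ ha.1) ha.2 (hb₁.trans hb.1) hb.2 hc₁ hc.1 hν0 hν1
      (hexB _ _ _ _ hΔ ha hb hc) (hexB _ _ _ _ hΔ1m ha hb hc) (hexB _ _ _ _ hΔ1m ha2m hb hc) (hexB _ _ _ _ hΔ1m ha2m hb2m hc)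
      (hexB _ _ _ _ hΔ1m ha2m hb2m hc1m)

end Summit.Ventures.CertifiedManyBodySolver.Downfold.Emery
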